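import Mathlib.RingTheory.Flat.FaithfullyFlat.Algebra
import Mathlib.RingTheory.Flat.TorsionFree
import Mathlib.RingTheory.IntegralClosure.IntegrallyClosed
import Mathlib.RingTheory.Localization.FractionRing
import HarnessLib

/-!
# Normality descends along faithfully flat ring maps

Topic: `Literature/RingTheory/Flat` (companion of `NormalityGoesUp.lean`). The Stacks Project,
Tag 033G ("Descending properties", Lemma 35.18.2 / Algebra Lemma 10.164.3): if `A → B` is
faithfully flat and `B` is a normal domain then `A` is a normal domain. We prove the domain form
Mathlib can state (`IsIntegrallyClosed` = integrally closed in the fraction field):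

* `isIntegrallyClosed_of_faithfullyFlat_of_isDomain` — `A` a domain, `Module.FaithfullyFlat A B`,
  `B` (commutative, possibly with zero-divisors) integrally closed in its total ring of fractions
  (Mathlib's general `IsIntegrallyClosed B`) ⇒ `A` integrally closed;
* `isIntegrallyClosed_of_faithfullyFlat` — `Module.FaithfullyFlat A B`, `B` an integrally closed
  domain ⇒ `A` integrally closed (and a domain, `A → B` being injective).

Proof (loc. cit.): `A → B` is injective and flat, so non-zero elements of the domain `A` are
non-zero-divisors of `B` (Mathlib `Module.Flat.isSMulRegular_of_nonZeroDivisors`) and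
`Frac A → Frac B` (the total ring of fractions) is defined; if `x = a/s ∈ Frac A` is integral over
`A` its image is integral over `B`, hence `x = b ∈ B`, i.e. `a = b s ∈ sB ∩ A = sA` (faithful
flatness: `IB ∩ A = I`, Mathlib `Ideal.comap_map_eq_self_of_faithfullyFlat`), so `x = a/s ∈ A`.

Used by `Literature/AlgebraicGeometry/Resolution/TameQuotientSingularitiesResolutionProofs.lean`
(normality of a scheme covered by étale charts from normal schemes). Only Mathlib is used.
[cite: StacksProject, Tag 033G]
-/

noncomputable section

namespace Literature.RingTheory.Flat

universe u v

variable (A : Type u) (B : Type v) [CommRing A] [CommRing B] [Algebra A B]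

/-- A faithfully flat algebra over `A` which is a domain forces `A` to be a domain (the structure
map is injective). [cite: StacksProject, Tag 033G] -/
theorem isDomain_of_faithfullyFlat [Module.FaithfullyFlat A B] [IsDomain B] : IsDomain A :=
  (FaithfulSMul.algebraMap_injective A B).isDomain _

/-- **Normality descends along faithfully flat maps** (Stacks 033G), general target: if `A` is
a domain and `B` is a faithfully flat `A`-algebra which is integrally closed in its total ring of
fractions, then `A` is integrally closed. [cite: StacksProject, Tag 033G] -/
theorem isIntegrallyClosed_of_faithfullyFlat_of_isDomain [IsDomain A] [Module.FaithfullyFlat A B]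
    [IsIntegrallyClosed B] : IsIntegrallyClosed A := by
  let L := FractionRing B
  -- non-zero elements of `A` are non-zero-divisors of the flat `A`-algebra `B`
  have hreg : ∀ s : nonZeroDivisors A, algebraMap A B s ∈ nonZeroDivisors B := fun s => by
    rw [mem_nonZeroDivisors_iff_right]
    intro b hb
    have h := Module.Flat.isSMulRegular_of_nonZeroDivisors (M := B) s.2
    refine h ?_
    change (s : A) • b = (s : A) • 0
    rw [smul_zero, Algebra.smul_def, mul_comm]
    exact hb
  -- hence units of `Frac B`, and `Frac A → Frac B` is defined
  have hu : ∀ s : nonZeroDivisors A, IsUnit (Algebra.ofId A L s) := fun s => by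
    rw [Algebra.ofId_apply, IsScalarTower.algebraMap_apply A B L]
    exact IsLocalization.map_units L (⟨_, hreg s⟩ : nonZeroDivisors B)
  let f : FractionRing A →ₐ[A] L :=
    IsLocalization.liftAlgHom (M := nonZeroDivisors A) (f := Algebra.ofId A L) hu
  rw [isIntegrallyClosed_iff (FractionRing A)]
  intro x hx
  obtain ⟨⟨a, s⟩, rfl⟩ := IsLocalization.mk'_surjective (nonZeroDivisors A) x
  -- the image of `x` in `Frac B` is integral over `B`, hence an element `b ∈ B`
  obtain ⟨b, hb⟩ := (IsIntegrallyClosed.isIntegral_iff (R := B) (K := L)).mp (hx.map f).tower_top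
  -- `b * s = a` in `B`
  have hbs : b * algebraMap A B s = algebraMap A B a := by
    apply IsFractionRing.injective B L
    have h1 := congrArg f (IsLocalization.mk'_spec (FractionRing A) a s)
    rw [map_mul, AlgHom.commutes, AlgHom.commutes, ← hb,
      IsScalarTower.algebraMap_apply A B L (s : A), IsScalarTower.algebraMap_apply A B L a,
      ← map_mul] at h1
    exact h1
  -- faithful flatness: `a ∈ sB ∩ A = sA`
  have ha : a ∈ Ideal.span {(s : A)} := by
    rw [← Ideal.comap_map_eq_self_of_faithfullyFlat (B := B) (Ideal.span {(s : A)}),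
      Ideal.mem_comap, Ideal.map_span, Set.image_singleton]
    exact Ideal.mem_span_singleton'.mpr ⟨b, hbs⟩
  obtain ⟨a', ha'⟩ := Ideal.mem_span_singleton'.mp ha
  refine ⟨a', ?_⟩
  rw [IsLocalization.eq_mk'_iff_mul_eq, ← map_mul, ha']

/-- **Normality descends along faithfully flat maps** (Stacks 033G, domain form): if `B` is a
faithfully flat `A`-algebra and `B` is an integrally closed domain, then `A` is an integrally
closed domain. [cite: StacksProject, Tag 033G] -/
theorem isIntegrallyClosed_of_faithfullyFlat [Module.FaithfullyFlat A B] [IsDomain B]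
    [IsIntegrallyClosed B] : IsIntegrallyClosed A := by
  haveI : IsDomain A := isDomain_of_faithfullyFlat A B
  exact isIntegrallyClosed_of_faithfullyFlat_of_isDomain A B

end Literature.RingTheory.Flat

end
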